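import Summits.BirchSwinnertonDyer.BirchSwinnertonDyer.Theorems.ByReductionTypeAtTwoOrdKatoHalfAtTwoIsoOmegaRoadDefs
import Summits.BirchSwinnertonDyer.BirchSwinnertonDyer.Theorems.ByReductionTypeAtTwoOrdKatoHalfAtTwoIsoSelmerSideTwo
import Summits.BirchSwinnertonDyer.BirchSwinnertonDyer.Theorems.ByReductionTypeAtTwoOrdKatoHalfAtTwoIsoChebotarevTranspositionTwo
import Summits.BirchSwinnertonDyer.BirchSwinnertonDyer.Theorems.ByReductionTypeAtTwoOrdKatoHalfAtTwoIsoKolyvaginRankOneTwo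
import HarnessLib

/-!
# Stub-critic closure probe (gen 2) for `stub_port : CoreTheoremATwoResidue`
# (crux `ByReductionTypeAtTwo.OrdKatoHalfAtTwoIso`, stmt-BirchSwinnertonDyer-19573, line `steinberg-fibre-at-two`)

Seat `scrit-stub_port` (planner, stub-critic), gen 2, 2026-08-28. Scratch / evidence only — NOT a Theorems proposal,
nothing new is asserted. Purpose: certify BY NAME and in the kernel that the statement the two stub-ideation files and
STUB-PLAN rev 1 planned for — `SteinbergFibreAtTwo.CoreTheoremATwoResidue` (p655368, the v3/v4 skeleton's `stub_port`)
— is now a THEOREM of the tree, from the three Ω-road statements landed by the lead and its workers: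
T1 `stub_T1_selmerSideTwo` (p663770), Ω1 `stub_HC_chebotarevTranspositionTwo` (p662346),
Ω2 `stub_HK_kolyvaginRankOneTwo` (p668150), composed by the kernel theorem `stub_port_of_rankOne` (p658966).
`#print axioms` must list only `propext`, `Classical.choice`, `Quot.sound` (no `sorryAx`, no project axiom).
The second theorem restates the payload's VERBATIM signature of `stub_port` (skeleton v3 l.213–229) and closes it
by the first, i.e. the helper list implies the stub binder for binder. The third displays what the LINE still
owes by name after socket 1 closed (memo/cite binders only). BSD is not proved by any of this; the crux
`OrdKatoHalfAtTwoIso` is not proved by any of this.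
-/

set_option autoImplicit false
set_option linter.dupNamespace false

noncomputable section

open scoped Classical NumberField MatrixGroups ModularForm
open WeierstrassCurve Field IsDedekindDomain NumberField
open Literature.NumberTheory.GaloisRepresentations
open Literature.NumberTheory.GaloisCohomology
open Literature.NumberTheory.EllipticCurves
open Literature.NumberTheory.EllipticCurves.Kato2004
open Literature.NumberTheory.EllipticCurves.Kato2004.EulerSystemValues
open Summit.BirchSwinnertonDyer.BirchSwinnertonDyer.Theorems.SteinbergFibreAtTwo
open Literature.NumberTheory.EllipticCurves.ModularForms
open Summit.BirchSwinnertonDyer.BirchSwinnertonDyer.Theorems.OrdKatoIntAtTwo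
open Summit.BirchSwinnertonDyer.BirchSwinnertonDyer.Theorems.OrdKatoOptimalAtTwo
open CongruenceSubgroup

namespace Summit.BirchSwinnertonDyer.BirchSwinnertonDyer.Cruxes.OrdKatoHalfAtTwoIso.StubCriticStubPortG2

/-- **`stub_port` is closed BY NAME**: `CoreTheoremATwoResidue` from the three landed Ω-road theorems through the
kernel composition `stub_port_of_rankOne`. [cite: MazurRubin2004, Prop. 1.3.2 and §3] -/
theorem stub_port_closed : CoreTheoremATwoResidue :=
  stub_port_of_rankOne stub_T1_selmerSideTwo stub_HC_chebotarevTranspositionTwo stub_HK_kolyvaginRankOneTwo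

/-- **Binder-for-binder**: the payload's verbatim `stub_port` signature (skeleton v3 l.213–229 = p655368 l.96 body),
closed by `stub_port_closed` through the unfolding lemma `coreTheoremATwoResidue_iff`. [folklore] -/
theorem stub_port_signature_verbatim :
    ∀ (W : WeierstrassCurve ℚ) [W.IsElliptic] [W.IsGloballyMinimal]
      [ContinuousSMul ℤ_[2] (W.tateModule 2)] [Module.Free ℤ_[2] (W.tateModule 2)]
      [Module.Finite ℤ_[2] (W.tateModule 2)]
      (κ : ZpExtension ℚ 2) (γ : absoluteGaloisGroup ℚ) (I : IwasawaH1Data W 2 κ γ)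
      (hκ : κ.IsCyclotomic),
      W.HasGoodReductionAtPrime 2 → ¬ (2 : ℤ) ∣ W.frobeniusTrace 2 →
      W.HasSurjectiveModNGaloisRep 2 → W.Δ < 0 → κ.IsTopGenerator γ →
      (∃ s : I.H, IsEulerSystemClassTwo W hκ I s ∧
        s ∉ IwasawaAlgebra.augIdealP 2 • (⊤ : Submodule (IwasawaAlgebra 2) I.H)) →
      ∃ J : ℕ, ∀ y : Literature.NumberTheory.EllipticCurves.subgroupH1 κ.kerSubgroup
          (WeierstrassCurve.geomTorsion W (2 : ℤ)),
        W.torsionToPrimaryH1Sub 2 κ.kerSubgroup y ∈ W.fineSelmerInfty κ →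
          (⇑(Literature.NumberTheory.EllipticCurves.conjH1 κ.kerSubgroup
              (WeierstrassCurve.geomTorsion W (2 : ℤ)) γ -
            AddMonoidHom.id (Literature.NumberTheory.EllipticCurves.subgroupH1 κ.kerSubgroup
              (WeierstrassCurve.geomTorsion W (2 : ℤ)))))^[J] y = 0 :=
  coreTheoremATwoResidue_iff.mp stub_port_closed

/-- **What the LINE still owes after socket 1 closed, by name** — the crux from the four remaining registered stubs of
skeleton v7 (`stub_F1_two` memo tier, `stub_AU` cite, `stub_B7B8_…` memo, `stub_pub` cite via its third conjunct `h17`):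
one application of `ordKatoHalfAtTwoIso_of_sockets` (p655368) with `hport := stub_port_closed`. Conditional; nothing closed.
[cite: Kato2004Asterisque, Thm. 17.4 (1)(2) (p. 273)] [cite: AbbesUllmo1996, Thm. A] -/
theorem crux_of_remaining_binders (hF1 : DivisibilityInputsFineZetaAtTwoResidue)
    (hAU : abbesUllmo_not_dvd_maninConstant_of_not_dvd_level)
    (hB7 : KatoMuPartAtOptimalMemberOfNotSurjectiveTwo) (hB8 : KatoIntAtGoodOrdSurjectiveTwo)
    (h17 : ∀ (V : WeierstrassCurve ℚ) [V.IsElliptic] [V.IsGloballyMinimal] [NeZero (V.conductorNorm ℤ)]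
      (f : CuspForm (CongruenceSubgroup.Gamma0 (V.conductorNorm ℤ)) 2), kato_divisibility_allPrimes V 2 (f := f)) :
    Summit.BirchSwinnertonDyer.BirchSwinnertonDyer.Theses.ByReductionTypeAtTwo.OrdKatoHalfAtTwoIso :=
  ordKatoHalfAtTwoIso_of_sockets stub_port_closed hF1 hAU hB7 hB8 h17

/-- `μ(X(E/ℚ_∞)) = 0` on the residue now depends on ONE open binder, socket 2 (memo tier). [cite: Kato2004Asterisque, §17.13 (pp. 279–280) (shape)] -/
theorem mu_eq_zero_on_residue_of_socket2 (hF1 : DivisibilityInputsFineZetaAtTwoResidue)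
    (W : WeierstrassCurve ℚ) [W.IsElliptic] [W.IsGloballyMinimal]
    (hcm : ¬ W.HasCM) (hgo : Rank1Residual.GoodOrd W 2) (h2 : W.HasSurjectiveModNGaloisRep 2)
    (hns : ¬ Summit.BirchSwinnertonDyer.Rank1Residual.X5.O1.TwoAdicSurjective W) {N : ℕ} [NeZero N]
    (f : CuspForm (CongruenceSubgroup.Gamma0 N) 2)
    (hf : ModularForms.IsNewformOf W f) (κ : ZpExtension ℚ 2) (γ : absoluteGaloisGroup ℚ)
    (hκ : κ.IsCyclotomic) (hγ : κ.IsTopGenerator γ) (hγ' : IsCyclotomicVariable 2 γ)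
    (D : W.SelmerDualData κ γ) : D.mu = 0 :=
  mu_eq_zero_on_residue_of_sockets stub_port_closed hF1 W hcm hgo h2 hns f hf κ γ hκ hγ hγ' D

#print axioms stub_port_closed
#print axioms stub_T1_selmerSideTwo
#print axioms stub_HC_chebotarevTranspositionTwo
#print axioms stub_HK_kolyvaginRankOneTwo

end Summit.BirchSwinnertonDyer.BirchSwinnertonDyer.Cruxes.OrdKatoHalfAtTwoIso.StubCriticStubPortG2

end
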